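import Summits.AtomisticToContinuum.FouriersLaw.Theorems.PhononMeanFreePathIncoherentChannelLightConeHelper4
import Summits.AtomisticToContinuum.FouriersLaw.Theorems.PhononMeanFreePathIncoherentChannelLightConeHelper6

/-!
# Light-cone stub, helper 7: the Gibbs-mean finite-speed-of-propagation estimate

Helper for the registered stub `stub_lightCone` of line `two-horizons-forecast-loss`
(crux `PhononMeanFreePath.IncoherentChannel`, stmt-AtomisticToContinuum-11811), registered sub-goal
`lightCone_propagation_lintegral`.

Two copies of the constructed Langevin chain (`solMap`, SAME Brownian pair) are started from
`z ~ μ₀` and from `z̃` = `z` with `p₀` resampled from `N(0,T)`; `δ = p_N(t) - p̃_N(t)` is the far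
discrepancy. We prove, for every `k` (`M = 2^k`), with `C = C(ω₂, lam, β, T, k)` independent of `N, t`:

  `E[δ²] ≤ 4T · e^{Λ} Λ^N/N! + C · t^M √(N+1) / Λ^M`   for all `N`, `t ≥ 0`, `Λ > 0`.

Proof: pathwise (helper 4) `δ² ≤ (p₀ - s)² e^{A} A^N/N!` with the random clock `A = 4∫₀ᵗ c`;
on `{A ≤ Λ}` this is `≤ (p₀-s)² e^Λ Λ^N/N!`, on `{A > Λ}` the crude bound `δ² ≤ 2p_N² + 2p̃_N²` is
multiplied by `(A/Λ)^M ≥ 1`. Then Cauchy–Schwarz (helper 6), stationarity of both copies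
(`E p_N⁴ = E p̃_N⁴ = ∫ s⁴ dN(0,T)`), Jensen for the clock `A^{2M} ≤ 16^M t^{2M-1} ∫₀ᵗ c^{2M}`,
Tonelli in time and the rate moments `E c(r)^{2M} ≤ C_r (N+1)` (helper 6, from the `N`-uniform
Gibbs position moments of helper 5).
-/

noncomputable section

namespace Summit.AtomisticToContinuum.FouriersLaw.Theorems.PhononMeanFreePath

open MeasureTheory ProbabilityTheory Set Filter Topology
open scoped NNReal ENNReal
open Literature.MathematicalPhysics.KineticTheory.HeatConduction
open Literature.MathematicalPhysics.KineticTheory Literature.Probability.Process OscillatorChain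
open Summit.AtomisticToContinuum.FouriersLaw.Theorems.IncoherentChannel.Negative.GibbsStein (gibbs_sq_momentum)

/-- The pointwise two-horizon split behind the Gibbs-mean light cone (real arithmetic): if
`d ≤ w e^{A} A^N/N!` and `d ≤ F` with `w, F, A ≥ 0`, then for `Λ > 0`, `M`:
`d ≤ w e^{Λ} Λ^N/N! + F (A/Λ)^M`. -/
theorem lightCone_split_le {d w F A Λ : ℝ} {N M : ℕ} (hw : 0 ≤ w) (hF : 0 ≤ F) (hA : 0 ≤ A) (hΛ : 0 < Λ)
    (h1 : d ≤ w * Real.exp A * A ^ N / N.factorial) (h2 : d ≤ F) :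
    d ≤ w * (Real.exp Λ * Λ ^ N / N.factorial) + F * (A / Λ) ^ M := by
  have hfac : (0 : ℝ) < N.factorial := by positivity
  by_cases hAΛ : A ≤ Λ
  · have h3 : w * Real.exp A * A ^ N / N.factorial ≤ w * (Real.exp Λ * Λ ^ N / N.factorial) := by
      rw [show w * Real.exp A * A ^ N / N.factorial = w * (Real.exp A * A ^ N / N.factorial) by ring]
      refine mul_le_mul_of_nonneg_left ?_ hw
      refine div_le_div_of_nonneg_right ?_ hfac.le
      exact mul_le_mul (Real.exp_le_exp.2 hAΛ) (pow_le_pow_left₀ hA hAΛ N) (by positivity) (by positivity)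
    have h4 : 0 ≤ F * (A / Λ) ^ M := by positivity
    linarith
  · have h3 : 1 ≤ (A / Λ) ^ M := one_le_pow₀ ((one_le_div hΛ).2 (le_of_lt (not_le.1 hAΛ)))
    have h4 : F ≤ F * (A / Λ) ^ M := by nlinarith
    have h5 : 0 ≤ w * (Real.exp Λ * Λ ^ N / N.factorial) := by positivity
    linarith

section Estimate

variable {ω₂ lam β γ T : ℝ} (hω : 0 < ω₂) (hl : 0 ≤ lam) (hβ : 0 ≤ β) (hγ : 0 ≤ γ) (hT : 0 < T) (N : ℕ)
include hω hl hβ hγ hT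

omit hγ in
/-- `E[(p₀ - s)²] ≤ 4T` over `(μ₀ ⊗ N(0,T)) ⊗ W` (in lintegral form). -/
theorem lightCone_lintegral_sq_sub_le :
    ∫⁻ q : (PhaseSpace (N + 1) × ℝ) × WienerPair, ENNReal.ofReal ((q.1.1.2 0 - q.1.2) ^ 2)
        ∂((((pinnedChain ω₂ lam β γ).gibbsMeasure (N + 1) T).prod (gaussianReal 0 T.toNNReal)).prod wienerPair) ≤
      ENNReal.ofReal (4 * T) := by
  set μ₀ := (pinnedChain ω₂ lam β γ).gibbsMeasure (N + 1) T with hμ₀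
  set ν := gaussianReal 0 T.toNNReal with hν
  haveI : IsProbabilityMeasure μ₀ := pinnedChain_isProbabilityMeasure_gibbsMeasure hω hl hβ γ (N + 1) hT
  have hp2 : Integrable (fun z : PhaseSpace (N + 1) => z.2 0 ^ 2) μ₀ := lightCone_integrable_momentum_pow hω hl hβ hT 0 2
  have hs2 : Integrable (fun s : ℝ => s ^ 2) ν := lightCone_integrable_pow_gaussianReal T 2
  have hT2 : ∫ s, s ^ 2 ∂ν = T := by
    rw [hν, ← lightCone_integral_momentum_pow hω hl hβ hT (0 : Fin (N + 1)) 2 (γ := γ)]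
    exact gibbs_sq_momentum hω hl hβ hT 0
  have hh : Integrable (fun x : PhaseSpace (N + 1) × ℝ => 2 * x.1.2 0 ^ 2 + 2 * x.2 ^ 2) (μ₀.prod ν) :=
    ((hp2.comp_fst ν).const_mul 2).add ((hs2.comp_snd μ₀).const_mul 2)
  have hval : ∫ x : PhaseSpace (N + 1) × ℝ, (2 * x.1.2 0 ^ 2 + 2 * x.2 ^ 2) ∂(μ₀.prod ν) = 4 * T := by
    rw [integral_add ((hp2.comp_fst ν).const_mul 2) ((hs2.comp_snd μ₀).const_mul 2), integral_const_mul,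
      integral_const_mul, integral_fun_fst (fun z : PhaseSpace (N + 1) => z.2 0 ^ 2), integral_fun_snd (fun s : ℝ => s ^ 2),
      probReal_univ, probReal_univ, one_smul, one_smul, gibbs_sq_momentum hω hl hβ hT 0, hT2]
    ring
  have hhW := hh.comp_fst wienerPair
  calc ∫⁻ q : (PhaseSpace (N + 1) × ℝ) × WienerPair, ENNReal.ofReal ((q.1.1.2 0 - q.1.2) ^ 2) ∂((μ₀.prod ν).prod wienerPair)
      ≤ ∫⁻ q : (PhaseSpace (N + 1) × ℝ) × WienerPair, ENNReal.ofReal (2 * q.1.1.2 0 ^ 2 + 2 * q.1.2 ^ 2)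
          ∂((μ₀.prod ν).prod wienerPair) :=
        lintegral_mono fun q => ENNReal.ofReal_le_ofReal (by nlinarith [sq_nonneg (q.1.1.2 0 + q.1.2)])
    _ = ENNReal.ofReal (∫ q : (PhaseSpace (N + 1) × ℝ) × WienerPair, (2 * q.1.1.2 0 ^ 2 + 2 * q.1.2 ^ 2)
          ∂((μ₀.prod ν).prod wienerPair)) :=
        (ofReal_integral_eq_lintegral_ofReal hhW (Eventually.of_forall fun q => by positivity)).symm
    _ = ENNReal.ofReal (4 * T) := by
        rw [integral_fun_fst (fun x : PhaseSpace (N + 1) × ℝ => 2 * x.1.2 0 ^ 2 + 2 * x.2 ^ 2), probReal_univ,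
          one_smul, hval]

/-- `E[p_N(t)⁴] = ∫ s⁴ dN(0,T)` for the first copy and for the resampled copy (stationarity). -/
theorem lightCone_lintegral_far_pow_four (t : ℝ≥0) :
    ∫⁻ q : (PhaseSpace (N + 1) × ℝ) × WienerPair,
        ENNReal.ofReal ((((pinnedChain ω₂ lam β γ).solMap (N + 1) T T t q.1.1 (pairPath q.2)).2 (Fin.last N)) ^ 4)
        ∂((((pinnedChain ω₂ lam β γ).gibbsMeasure (N + 1) T).prod (gaussianReal 0 T.toNNReal)).prod wienerPair) =
      ENNReal.ofReal (∫ s, s ^ 4 ∂(gaussianReal 0 T.toNNReal)) ∧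
    ∫⁻ q : (PhaseSpace (N + 1) × ℝ) × WienerPair,
        ENNReal.ofReal ((((pinnedChain ω₂ lam β γ).solMap (N + 1) T T t
          ((q.1.1.1, Function.update q.1.1.2 0 q.1.2) : PhaseSpace (N + 1)) (pairPath q.2)).2 (Fin.last N)) ^ 4)
        ∂((((pinnedChain ω₂ lam β γ).gibbsMeasure (N + 1) T).prod (gaussianReal 0 T.toNNReal)).prod wienerPair) =
      ENNReal.ofReal (∫ s, s ^ 4 ∂(gaussianReal 0 T.toNNReal)) := by
  have hgm : Measurable fun y : PhaseSpace (N + 1) => ENNReal.ofReal ((y.2 (Fin.last N)) ^ 4) :=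
    (((measurable_pi_apply _).comp measurable_snd).pow_const 4).ennreal_ofReal
  have hval : ∫⁻ y, ENNReal.ofReal ((y.2 (Fin.last N)) ^ 4) ∂((pinnedChain ω₂ lam β γ).gibbsMeasure (N + 1) T) =
      ENNReal.ofReal (∫ s, s ^ 4 ∂(gaussianReal 0 T.toNNReal)) := by
    rw [← ofReal_integral_eq_lintegral_ofReal (lightCone_integrable_momentum_pow hω hl hβ hT (Fin.last N) 4)
      (Eventually.of_forall fun y => by positivity), lightCone_integral_momentum_pow hω hl hβ hT (Fin.last N) 4]
  exact ⟨(lightCone_lintegral_solMap_fst hω hl hβ hγ N hT t hgm).trans hval,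
    (lightCone_lintegral_solMap_resample hω hl hβ hγ N hT t hgm).trans hval⟩

end Estimate

/-- **Registered helper `lightCone_propagation_lintegral` — finite speed of propagation in Gibbs
mean.** For `P = pinnedChain ω₂ lam β γ` (`ω₂ > 0`, `lam, β, γ ≥ 0`), `T > 0` and every `k`
(`M = 2^k`) there is `C ≥ 0` such that for all `N`, `t ≥ 0`, `Λ > 0`:
`E[(p_N(t) - p̃_N(t))²] ≤ 4T e^{Λ}Λ^N/N! + C t^M √(N+1)/Λ^M`, the expectation over the Gibbs
initial state, the resampled momentum `p₀ ~ N(0,T)` of the second copy and the common noise. -/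
theorem lightCone_propagation_lintegral : ∀ ω₂ lam β γ : ℝ, 0 < ω₂ → 0 ≤ lam → 0 ≤ β → 0 ≤ γ → ∀ T : ℝ, 0 < T →
    ∀ k : ℕ, ∃ C : ℝ, 0 ≤ C ∧ ∀ (N : ℕ) (t : ℝ), 0 ≤ t → ∀ Λ : ℝ, 0 < Λ →
      ∫⁻ q : (PhaseSpace (N + 1) × ℝ) × WienerPair,
          ENNReal.ofReal ((((pinnedChain ω₂ lam β γ).solMap (N + 1) T T t q.1.1 (pairPath q.2)).2 (Fin.last N) -
            ((pinnedChain ω₂ lam β γ).solMap (N + 1) T T t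
              ((q.1.1.1, Function.update q.1.1.2 0 q.1.2) : PhaseSpace (N + 1)) (pairPath q.2)).2 (Fin.last N)) ^ 2)
          ∂((((pinnedChain ω₂ lam β γ).gibbsMeasure (N + 1) T).prod (ProbabilityTheory.gaussianReal 0 T.toNNReal)).prod
            wienerPair) ≤
        ENNReal.ofReal (4 * T * (Real.exp Λ * Λ ^ N / N.factorial) +
          C * t ^ (2 ^ k) * Real.sqrt (N + 1) / Λ ^ (2 ^ k)) := by
  intro ω₂ lam β γ hω hl hβ hγ T hT k
  set M : ℕ := 2 ^ k with hMdef
  have hM1 : 1 ≤ M := Nat.one_le_two_pow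
  obtain ⟨Cr, hCr0, hCr⟩ := lightCone_rate_moment ω₂ lam β γ hω hl hβ hγ T hT (2 * M) (by omega)
  set M4 : ℝ := ∫ s, s ^ 4 ∂(gaussianReal 0 T.toNNReal) with hM4
  have hM40 : 0 ≤ M4 := integral_nonneg fun s => by positivity
  refine ⟨4 ^ (M + 1) * Real.sqrt M4 * Real.sqrt Cr, by positivity, fun N t ht Λ hΛ => ?_⟩
  set P := pinnedChain ω₂ lam β γ with hP
  set μ₀ := P.gibbsMeasure (N + 1) T with hμ₀
  set ν := gaussianReal 0 T.toNNReal with hν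
  set 𝓜 := (μ₀.prod ν).prod wienerPair with h𝓜
  haveI : IsProbabilityMeasure μ₀ := pinnedChain_isProbabilityMeasure_gibbsMeasure hω hl hβ γ (N + 1) hT
  haveI : IsProbabilityMeasure 𝓜 := by rw [h𝓜]; infer_instance
  set tN : ℝ≥0 := ⟨t, ht⟩ with htN
  have htt : ((tN : ℝ≥0) : ℝ) = t := rfl
  -- the two copies at time `t`, as functions of `q = ((z, s), ω)`
  set R : PhaseSpace (N + 1) × ℝ → PhaseSpace (N + 1) := fun x => (x.1.1, Function.update x.1.2 0 x.2) with hR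
  set Xf : (PhaseSpace (N + 1) × ℝ) × WienerPair → ℝ := fun q => (P.solMap (N + 1) T T t q.1.1 (pairPath q.2)).2 (Fin.last N)
    with hXf
  set Xr : (PhaseSpace (N + 1) × ℝ) × WienerPair → ℝ := fun q => (P.solMap (N + 1) T T t (R q.1) (pairPath q.2)).2 (Fin.last N)
    with hXr
  have hXfm : Measurable Xf := ((measurable_pi_apply _).comp measurable_snd).comp (lightCone_measurable_solMap_fst hω hl hβ hγ N T t)
  have hXrm : Measurable Xr :=
    ((measurable_pi_apply _).comp measurable_snd).comp (lightCone_measurable_solMap_resample hω hl hβ hγ N T t)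
  -- the local rate and the clock
  set cf : (PhaseSpace (N + 1) × ℝ) × WienerPair → ℝ → ℝ := fun q r => 1 + 5 * ((ω₂ + 1) + 8 * (lam + β) *
    (‖(P.solMap (N + 1) T T r q.1.1 (pairPath q.2)).1‖ ^ 2 + ‖(P.solMap (N + 1) T T r (R q.1) (pairPath q.2)).1‖ ^ 2)) with hcf
  have hcf1 : ∀ q r, 1 ≤ cf q r := fun q r => by
    simp only [hcf]
    have : 0 ≤ 5 * ((ω₂ + 1) + 8 * (lam + β) * (‖(P.solMap (N + 1) T T r q.1.1 (pairPath q.2)).1‖ ^ 2 +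
      ‖(P.solMap (N + 1) T T r (R q.1) (pairPath q.2)).1‖ ^ 2)) := by positivity
    linarith
  have hcf0 : ∀ q r, 0 ≤ cf q r := fun q r => zero_le_one.trans (hcf1 q r)
  have hcfc : ∀ q, Continuous (cf q) := fun q => by
    simp only [hcf]
    have h1 := (continuous_fst.comp (pinnedChain_continuous_solMap hω hl hβ hγ (N + 1) T T q.1.1 (pairPath q.2))).norm
    have h2 := (continuous_fst.comp (pinnedChain_continuous_solMap hω hl hβ hγ (N + 1) T T (R q.1) (pairPath q.2))).norm
    fun_prop
  -- joint measurability of the rate in `(q, r)`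
  have hcfj : Measurable fun p : ((PhaseSpace (N + 1) × ℝ) × WienerPair) × ℝ => cf p.1 p.2 := by
    simp only [hcf]
    have hu := pinnedChain_measurable_uncurry_solMap hω hl hβ hγ (N + 1) T T
    have g1 : Measurable fun p : ((PhaseSpace (N + 1) × ℝ) × WienerPair) × ℝ => (p.2, (p.1.1.1, pairPath p.1.2)) :=
      measurable_snd.prodMk (((measurable_fst.comp measurable_fst).comp measurable_fst).prodMk
        (measurable_pairPath.comp (measurable_snd.comp measurable_fst)))
    have g2 : Measurable fun p : ((PhaseSpace (N + 1) × ℝ) × WienerPair) × ℝ => (p.2, (R p.1.1, pairPath p.1.2)) :=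
      measurable_snd.prodMk ((((lightCone_measurable_resample 0).comp measurable_fst).comp measurable_fst).prodMk
        (measurable_pairPath.comp (measurable_snd.comp measurable_fst)))
    have m1 := (measurable_fst.comp (hu.comp g1)).norm
    have m2 := (measurable_fst.comp (hu.comp g2)).norm
    exact measurable_const.add (measurable_const.mul (measurable_const.add
      (measurable_const.mul ((m1.pow_const 2).add (m2.pow_const 2)))))
  set A : (PhaseSpace (N + 1) × ℝ) × WienerPair → ℝ := fun q => 4 * ∫ r in (0:ℝ)..t, cf q r with hA
  have hA0 : ∀ q, 0 ≤ A q := fun q => mul_nonneg (by norm_num) (intervalIntegral.integral_nonneg ht fun r _ => hcf0 q r)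
  have hAm : Measurable A := by
    have h := (hcfj.stronglyMeasurable.integral_prod_right' (ν := volume.restrict (Ioc 0 t))).measurable
    have e : A = fun q => 4 * ∫ r in Ioc 0 t, cf q r := by
      funext q; simp only [hA]; rw [intervalIntegral.integral_of_le ht]
    rw [e]
    exact h.const_mul 4
  -- pathwise light cone and the crude bound
  have hpath : ∀ q, (Xf q - Xr q) ^ 2 ≤ (q.1.1.2 0 - q.1.2) ^ 2 * Real.exp (A q) * A q ^ N / N.factorial := fun q =>
    lightCone_pathwise ω₂ lam β γ hω hl hβ hγ T T N q.1.1 q.1.2 (pairPath q.2) t ht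
  have hcrude : ∀ q, (Xf q - Xr q) ^ 2 ≤ 2 * Xf q ^ 2 + 2 * Xr q ^ 2 := fun q => by nlinarith [sq_nonneg (Xf q + Xr q)]
  -- Jensen for the clock: `A^{2M} ≤ 16^M t^{2M-1} ∫₀ᵗ cf^{2M}`
  have hJ : ∀ q, A q ^ (2 * M) ≤ (16 : ℝ) ^ M * t ^ (2 * M - 1) * ∫ r in (0:ℝ)..t, cf q r ^ (2 * M) := by
    intro q
    have h := lightCone_pow_intervalIntegral_le (hcfc q) (hcf0 q) ht (k + 1)
    have e2 : 2 ^ (k + 1) = 2 * M := by rw [hMdef, pow_succ, mul_comm]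
    rw [e2] at h
    calc A q ^ (2 * M) = (4 : ℝ) ^ (2 * M) * (∫ r in (0:ℝ)..t, cf q r) ^ (2 * M) := by rw [hA]; simp only; rw [mul_pow]
      _ ≤ (4 : ℝ) ^ (2 * M) * (t ^ (2 * M - 1) * ∫ r in (0:ℝ)..t, cf q r ^ (2 * M)) :=
          mul_le_mul_of_nonneg_left h (by positivity)
      _ = (16 : ℝ) ^ M * t ^ (2 * M - 1) * ∫ r in (0:ℝ)..t, cf q r ^ (2 * M) := by
          rw [pow_mul, show (4 : ℝ) ^ 2 = 16 by norm_num]; ring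
  -- the pointwise split
  set e₁ : ℝ := Real.exp Λ * Λ ^ N / N.factorial with he₁
  have he₁0 : 0 ≤ e₁ := by positivity
  set F : (PhaseSpace (N + 1) × ℝ) × WienerPair → ℝ := fun q => 2 * Xf q ^ 2 + 2 * Xr q ^ 2 with hF
  set G : (PhaseSpace (N + 1) × ℝ) × WienerPair → ℝ := fun q => (A q / Λ) ^ M with hG
  have hF0 : ∀ q, 0 ≤ F q := fun q => by positivity
  have hG0 : ∀ q, 0 ≤ G q := fun q => by have := hA0 q; positivity
  have hFm : Measurable F := ((hXfm.pow_const 2).const_mul 2).add ((hXrm.pow_const 2).const_mul 2)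
  have hGm : Measurable G := (hAm.div_const Λ).pow_const M
  have hsplit : ∀ q, (Xf q - Xr q) ^ 2 ≤ (q.1.1.2 0 - q.1.2) ^ 2 * e₁ + F q * G q := fun q =>
    lightCone_split_le (sq_nonneg _) (hF0 q) (hA0 q) hΛ (hpath q) (hcrude q)
  -- (1) the in-cone term
  have hI1 : ∫⁻ q, ENNReal.ofReal ((q.1.1.2 0 - q.1.2) ^ 2 * e₁) ∂𝓜 ≤ ENNReal.ofReal (4 * T * e₁) := by
    have e : ∀ q : (PhaseSpace (N + 1) × ℝ) × WienerPair, ENNReal.ofReal ((q.1.1.2 0 - q.1.2) ^ 2 * e₁) =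
        ENNReal.ofReal ((q.1.1.2 0 - q.1.2) ^ 2) * ENNReal.ofReal e₁ := fun q => ENNReal.ofReal_mul (sq_nonneg _)
    simp_rw [e]
    rw [lintegral_mul_const' _ _ ENNReal.ofReal_ne_top, ENNReal.ofReal_mul' he₁0]
    exact mul_le_mul' (lightCone_lintegral_sq_sub_le hω hl hβ hT N) le_rfl
  -- (2a) fourth moments: `∫ (ofReal F)² ≤ ofReal (16 M4)`
  obtain ⟨h4f, h4r⟩ := lightCone_lintegral_far_pow_four hω hl hβ hγ hT N tN
  rw [htt] at h4f h4r
  have hF2 : ∫⁻ q, ENNReal.ofReal (F q) ^ 2 ∂𝓜 ≤ ENNReal.ofReal ((4 * Real.sqrt M4) ^ 2) := by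
    have hpt : ∀ q, ENNReal.ofReal (F q) ^ 2 ≤ ENNReal.ofReal 8 * ENNReal.ofReal (Xf q ^ 4) + ENNReal.ofReal 8 * ENNReal.ofReal (Xr q ^ 4) := by
      intro q
      rw [← ENNReal.ofReal_pow (hF0 q), ← ENNReal.ofReal_mul (by norm_num), ← ENNReal.ofReal_mul (by norm_num),
        ← ENNReal.ofReal_add (by positivity) (by positivity)]
      refine ENNReal.ofReal_le_ofReal ?_
      simp only [hF]
      nlinarith [sq_nonneg (Xf q ^ 2 - Xr q ^ 2)]
    calc ∫⁻ q, ENNReal.ofReal (F q) ^ 2 ∂𝓜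
        ≤ ∫⁻ q, (ENNReal.ofReal 8 * ENNReal.ofReal (Xf q ^ 4) + ENNReal.ofReal 8 * ENNReal.ofReal (Xr q ^ 4)) ∂𝓜 :=
          lintegral_mono hpt
      _ = ENNReal.ofReal 8 * ∫⁻ q, ENNReal.ofReal (Xf q ^ 4) ∂𝓜 + ENNReal.ofReal 8 * ∫⁻ q, ENNReal.ofReal (Xr q ^ 4) ∂𝓜 := by
          rw [lintegral_add_left ((hXfm.pow_const 4).ennreal_ofReal.const_mul _), lintegral_const_mul _ (hXfm.pow_const 4).ennreal_ofReal,
            lintegral_const_mul _ (hXrm.pow_const 4).ennreal_ofReal]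
      _ = ENNReal.ofReal 8 * ENNReal.ofReal M4 + ENNReal.ofReal 8 * ENNReal.ofReal M4 := by
          rw [h𝓜, hM4]; simp only [hXf, hXr, hR] ; rw [h4f, h4r]
      _ = ENNReal.ofReal ((4 * Real.sqrt M4) ^ 2) := by
          rw [← ENNReal.ofReal_mul (by norm_num), ← ENNReal.ofReal_add (by positivity) (by positivity)]
          congr 1
          rw [mul_pow, Real.sq_sqrt hM40]; ring
  -- (2b) the clock: `∫ (ofReal G)² ≤ ofReal (b²)`, `b = 4^M t^M √(Cr (N+1)) / Λ^M`
  have hG2 : ∫⁻ q, ENNReal.ofReal (G q) ^ 2 ∂𝓜 ≤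
      ENNReal.ofReal ((4 ^ M * t ^ M * Real.sqrt (Cr * (N + 1)) / Λ ^ M) ^ 2) := by
    -- pointwise: `G² ≤ κ ∫₀ᵗ cf^{2M}`, `κ = 16^M t^{2M-1} / Λ^{2M}`
    set κ : ℝ := (16 : ℝ) ^ M * t ^ (2 * M - 1) / Λ ^ (2 * M) with hκ
    have hκ0 : 0 ≤ κ := by positivity
    have hIc : ∀ q, IntegrableOn (fun r => cf q r ^ (2 * M)) (Ioc 0 t) := fun q =>
      (((hcfc q).pow (2 * M)).integrableOn_Icc).mono_set Ioc_subset_Icc_self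
    have hpt : ∀ q, ENNReal.ofReal (G q) ^ 2 ≤ ENNReal.ofReal κ * (∫⁻ r in Ioc 0 t, ENNReal.ofReal (cf q r ^ (2 * M))) := by
      intro q
      rw [← ofReal_integral_eq_lintegral_ofReal (hIc q) (Eventually.of_forall fun r => pow_nonneg (hcf0 q r) _),
        ← intervalIntegral.integral_of_le ht, ← ENNReal.ofReal_pow (hG0 q), ← ENNReal.ofReal_mul hκ0]
      refine ENNReal.ofReal_le_ofReal ?_
      have hJq := hJ q
      have hΛp : 0 < Λ ^ (2 * M) := pow_pos hΛ _
      calc G q ^ 2 = A q ^ (2 * M) / Λ ^ (2 * M) := by rw [hG]; simp only; rw [div_pow, div_pow, ← pow_mul, ← pow_mul, mul_comm M 2]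
        _ ≤ ((16 : ℝ) ^ M * t ^ (2 * M - 1) * ∫ r in (0:ℝ)..t, cf q r ^ (2 * M)) / Λ ^ (2 * M) :=
            div_le_div_of_nonneg_right hJq hΛp.le
        _ = κ * ∫ r in (0:ℝ)..t, cf q r ^ (2 * M) := by rw [hκ]; ring
    -- Tonelli in time and the rate moments
    have hsw : ∫⁻ q, (∫⁻ r in Ioc 0 t, ENNReal.ofReal (cf q r ^ (2 * M))) ∂𝓜 ≤ ENNReal.ofReal (Cr * (N + 1) * t) := by
      rw [lintegral_lintegral_swap ((hcfj.pow_const (2 * M)).ennreal_ofReal.aemeasurable)]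
      calc ∫⁻ r in Ioc 0 t, (∫⁻ q, ENNReal.ofReal (cf q r ^ (2 * M)) ∂𝓜)
          ≤ ∫⁻ _r in Ioc 0 t, ENNReal.ofReal (Cr * (N + 1)) := by
            refine setLIntegral_mono' measurableSet_Ioc fun r hr => ?_
            have := hCr N r hr.1.le
            rw [h𝓜]
            exact this
        _ = ENNReal.ofReal (Cr * (N + 1) * t) := by
            rw [setLIntegral_const, Real.volume_Ioc, sub_zero, ← ENNReal.ofReal_mul (by positivity)]
    calc ∫⁻ q, ENNReal.ofReal (G q) ^ 2 ∂𝓜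
        ≤ ∫⁻ q, ENNReal.ofReal κ * (∫⁻ r in Ioc 0 t, ENNReal.ofReal (cf q r ^ (2 * M))) ∂𝓜 := lintegral_mono hpt
      _ = ENNReal.ofReal κ * ∫⁻ q, (∫⁻ r in Ioc 0 t, ENNReal.ofReal (cf q r ^ (2 * M))) ∂𝓜 :=
          lintegral_const_mul' _ _ ENNReal.ofReal_ne_top
      _ ≤ ENNReal.ofReal κ * ENNReal.ofReal (Cr * (N + 1) * t) := mul_le_mul' le_rfl hsw
      _ = ENNReal.ofReal ((4 ^ M * t ^ M * Real.sqrt (Cr * (N + 1)) / Λ ^ M) ^ 2) := by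
          rw [← ENNReal.ofReal_mul hκ0]
          congr 1
          rw [hκ, div_pow, mul_pow, mul_pow, Real.sq_sqrt (by positivity), ← pow_mul, ← pow_mul,
            show (4 : ℝ) ^ (M * 2) = 16 ^ M by rw [mul_comm, pow_mul]; norm_num]
          obtain ⟨M', hM'⟩ : ∃ M', M = M' + 1 := ⟨M - 1, by omega⟩
          rw [hM']
          rw [show 2 * (M' + 1) - 1 = 2 * M' + 1 by omega, show (M' + 1) * 2 = 2 * M' + 1 + 1 by ring]
          field_simp
          ring
  -- (2) Cauchy–Schwarz
  have hI2 : ∫⁻ q, ENNReal.ofReal (F q) * ENNReal.ofReal (G q) ∂𝓜 ≤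
      ENNReal.ofReal ((4 * Real.sqrt M4) * (4 ^ M * t ^ M * Real.sqrt (Cr * (N + 1)) / Λ ^ M)) :=
    lightCone_lintegral_mul_le hFm.ennreal_ofReal.aemeasurable hGm.ennreal_ofReal.aemeasurable (by positivity)
      (by positivity) hF2 hG2
  -- assemble
  calc ∫⁻ q, ENNReal.ofReal ((Xf q - Xr q) ^ 2) ∂𝓜
      ≤ ∫⁻ q, (ENNReal.ofReal ((q.1.1.2 0 - q.1.2) ^ 2 * e₁) + ENNReal.ofReal (F q) * ENNReal.ofReal (G q)) ∂𝓜 := by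
        refine lintegral_mono fun q => ?_
        rw [← ENNReal.ofReal_mul (hF0 q), ← ENNReal.ofReal_add (by positivity) (mul_nonneg (hF0 q) (hG0 q))]
        exact ENNReal.ofReal_le_ofReal (hsplit q)
    _ = ∫⁻ q, ENNReal.ofReal ((q.1.1.2 0 - q.1.2) ^ 2 * e₁) ∂𝓜 + ∫⁻ q, ENNReal.ofReal (F q) * ENNReal.ofReal (G q) ∂𝓜 := by
        refine lintegral_add_left ?_ _
        refine Measurable.ennreal_ofReal ?_
        have h1 : Measurable fun q : (PhaseSpace (N + 1) × ℝ) × WienerPair => q.1.1.2 0 :=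
          (measurable_pi_apply 0).comp (measurable_snd.comp (measurable_fst.comp measurable_fst))
        have h2 : Measurable fun q : (PhaseSpace (N + 1) × ℝ) × WienerPair => q.1.2 := measurable_snd.comp measurable_fst
        exact ((h1.sub h2).pow_const 2).mul_const e₁
    _ ≤ ENNReal.ofReal (4 * T * e₁) + ENNReal.ofReal ((4 * Real.sqrt M4) * (4 ^ M * t ^ M * Real.sqrt (Cr * (N + 1)) / Λ ^ M)) :=
        add_le_add hI1 hI2
    _ = ENNReal.ofReal (4 * T * e₁ + 4 ^ (M + 1) * Real.sqrt M4 * Real.sqrt Cr * t ^ M * Real.sqrt (N + 1) / Λ ^ M) := by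
        rw [← ENNReal.ofReal_add (by positivity) (by positivity)]
        congr 1
        rw [Real.sqrt_mul hCr0, pow_succ]
        ring

end Summit.AtomisticToContinuum.FouriersLaw.Theorems.PhononMeanFreePath

end
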